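import Summits.ResolutionOfSingularities.ResolutionOfSingularities.Theorems.FrobeniusClosingPatchingRelPerfectDepthFlagLegalOldBoundaryTools
import Summits.ResolutionOfSingularities.ResolutionOfSingularities.Theorems.FrobeniusClosingPatchingRelPerfectDepthFlagLegalOldBoundary
import Summits.ResolutionOfSingularities.ResolutionOfSingularities.Theorems.FrobeniusClosingPatchingRelPerfectDepthFlagLegalComponentLabels
import Literature.AlgebraicGeometry.Resolution.AlterationsBoundaryDivisor
import Literature.AlgebraicGeometry.Resolution.AlterationsMultisectionLocalStepProofs
import Literature.AlgebraicGeometry.Resolution.DivisorialPartLemmas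
import Literature.AlgebraicGeometry.Resolution.TransversalUnionSNC
import Literature.AlgebraicGeometry.Resolution.BlowupsIntegral
import Literature.AlgebraicGeometry.Resolution.ExcellentBlowup
import Literature.AlgebraicGeometry.Resolution.BlowupsProduct
import Literature.AlgebraicGeometry.Resolution.BirationalDimensionInequality
import HarnessLib

/-!
# Chain W5.2 — F6 stage 1, residual `LegalDivisorReduction₃`, PHASE 2: the OURS binder `OldBoundaryResolution₃` DISCHARGED from the
# Cossart–Jannsen–Saito history construction-fact F-72 (`CossartJannsenSaito2020_canonicalSequence_history`, ν̃-form, p533571)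

[OURS · L1 W5.2 · res-D-pv-016 AS res-L1-w52-stub-5, (K-b) (res-L1-w52-plan-1 RULING G10-1 (1); res-L1-w52-idea-1 O3.3 (3)).]  NOT statements
of the manuscript under review; AI-written, weaker than expert review.  The ONLY non-kernel input is the explicit hypothesis
`(h72 : CossartJannsenSaito2020_canonicalSequence_history)` — a LIVE Literature named fact (F-72; CONSTRUCTION-level, ≤ print).
`oldBoundaryResolution₃_of_F72 : … → OldBoundaryResolution₃`, so with `legalPhaseTwo₃_of_oldBoundary` (p533480) `LegalPhaseTwo₃`
holds MODULO F-72 ONLY.  The (K-b) inference (tools in `…DepthFlagLegalOldBoundaryTools`): along F-72's process the host stays a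
REGULAR Cartier hypersurface with support the strict transform (`regularHost_controlledTransform`), so `H ≡ Φ^{(2)}`
(`hsFunOn_eq_iterPSum_of_isRegular`), every point is near and the history stays «the old labels through the point»
(`histTransform_eq_old`); a centre point carries a ROUND-START maximal value (ν̃-conjunct of `hmax`) of a non-`O`-equisingular
component, hence `|O(x)| ≥ 1` (`one_le_snd_of_maximal`): it lies on the strict transform of an INITIAL boundary component — the
`hold` clause of `IsOBPermissibleSequence`.  ENTRY: `B` presented by its irreducible components (`exists_componentLabelling`), host
as `D.subschemeι` (reduced, `dim ≤ 2`), «no host component in `B`» from the coheight clause (`not_subset_of_coheight`).  EXIT: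
`X₁ ∪ ⋃B₁ = Supp π^*(D·𝓘_B)` snc by `IsTransversalWith.isStrictNormalCrossingsDivisor_union`.
[cite: CossartJannsenSaito2020, Thm. 1.4, Cor. 6.26, Def. 6.23 (1)–(3), Rem. 6.24, (4.6), Def. 4.4 (b), Lemma 2.31]
[cite: BierstoneGrigorievMilmanWlodarczyk2011, §4 Remark (3)] [cite: DeJong1996, 2.4] [cite: StacksProject, Tag 02IZ]
-/

-- `Summit.<Summit>.<Sub>.Theorems` with `Sub = Summit` (single-conjunct summit, D-0017)
set_option linter.dupNamespace false

noncomputable section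

open CategoryTheory CategoryTheory.Limits AlgebraicGeometry TopologicalSpace IsLocalRing
open Literature.AlgebraicGeometry.Resolution Literature.RingTheory.HilbertSamuel
open Scheme.IdealSheafData

namespace Summit.ResolutionOfSingularities.ResolutionOfSingularities.Theorems.DepthLegal

universe u

/-! ## §1 The (K-b) transport along ONE `Σ^{O,max}`-elimination round -/

/-- local shorthand: the centre of an F-72 step lies in the (closed) strict transform -/
private theorem support_subset_of_hsub {Z' : Scheme.{u}} {X' : Set Z'} (hX'c : IsClosed X') {C : Z'.IdealSheafData}
    (hsub : vanishingIdeal ⟨closure X', isClosed_closure⟩ ≤ C) : (C.support : Set Z') ⊆ X' := by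
  intro x hx
  have hx' : x ∈ ((vanishingIdeal (⟨closure X', isClosed_closure⟩ : Closeds Z')).support : Set Z') :=
    Scheme.IdealSheafData.support_antitone hsub hx
  rw [Scheme.IdealSheafData.coe_support_vanishingIdeal] at hx'
  simpa [hX'c.closure_eq] using hx'

/-- An effective Cartier divisor on a nonempty scheme is not the zero ideal sheaf. [folklore] -/
private theorem ne_bot_of_isEffectiveCartier' {W : Scheme.{u}} [Nonempty W] {J : W.IdealSheafData}
    (hJ : IsEffectiveCartier J) : J ≠ ⊥ := by
  intro h0
  obtain ⟨U, hxU, g, hg, hU⟩ := hJ (Classical.arbitrary W)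
  rw [h0, Scheme.IdealSheafData.ideal_bot, Pi.bot_apply, eq_comm, Ideal.span_singleton_eq_bot] at hU
  subst hU
  haveI : Nonempty (U : W.Opens) := ⟨⟨_, hxU⟩⟩
  exact zero_notMem_nonZeroDivisors hg

/-- **(K-b) TRANSPORT ALONG ONE ROUND** of F-72's process: the invariant «regular hypersurface host with support the strict
transform, history = old labels through the point, old-label members closed and empty beyond the counter, the accumulated
`IsOBPermissibleSequence`, the Cartier pull-back of the END divisor» passes through every `IsSigmaOMaxElimination` step, each
centre lying on the strict transform of the INITIAL boundary by the lexicographic argument (`one_le_snd_of_maximal`) applied to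
the ROUND-START maximality conjunct of `hmax`. [cite: CossartJannsenSaito2020, Def. 6.23 (1), Rem. 6.24, (4.6), Def. 4.4 (b)] -/
theorem obInv_elimination
    {E : Scheme.{u}} {X₀ B₀ : Set E} {k : ℕ} {G₀ : E.IdealSheafData}
    {Zr : Scheme.{u}} [IsIntegral Zr] [IsNoetherian Zr] (hZr : Scheme.IsRegular Zr) (hdimr : topologicalKrullDim Zr = 3)
    {σ : Zr ⟶ E} {Xr : Set Zr} {Br : ℕ → Set Zr} {kr : ℕ} {Or : Zr → Set ℕ}
    (hkr : k ≤ kr) (hBr0 : ∀ j, kr ≤ j → Br j = ∅) (hBrc : ∀ j, IsClosed (Br j)) (hXrc : IsClosed Xr)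
    (hDr : ∃ Dr : Zr.IdealSheafData, IsEffectiveCartier Dr ∧ Scheme.IsRegular Dr.subscheme ∧ (Dr.support : Set Zr) = Xr)
    (hOr : ∀ x ∈ Xr, Or x = Set.Iio k ∩ BoundaryHistory.boundaryAt Br x)
    (hseqr : IsOBPermissibleSequence X₀ B₀ σ Xr (⋃ j ∈ Set.Iio k, Br j) (⋃ j, Br j))
    (hGr : IsEffectiveCartier (G₀.comap σ)) :
    ∀ {Z' : Scheme.{u}} {ρ : Z' ⟶ Zr} {X' : Set Z'} {B' : ℕ → Set Z'} {k' : ℕ} {O' : Z' → Set ℕ},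
      CJSHistory.IsSigmaOMaxElimination Xr Br kr Or 2 ρ X' B' k' O' →
      ∃ (_ : IsIntegral Z') (_ : IsNoetherian Z'), Scheme.IsRegular Z' ∧ topologicalKrullDim Z' = 3 ∧
        k ≤ k' ∧ (∀ j, k' ≤ j → B' j = ∅) ∧ (∀ j, IsClosed (B' j)) ∧ IsClosed X' ∧
        (∃ D' : Z'.IdealSheafData, IsEffectiveCartier D' ∧ Scheme.IsRegular D'.subscheme ∧
          (D'.support : Set Z') = X') ∧
        (∀ x ∈ X', O' x = Set.Iio k ∩ BoundaryHistory.boundaryAt B' x) ∧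
        IsOBPermissibleSequence X₀ B₀ (ρ ≫ σ) X' (⋃ j ∈ Set.Iio k, B' j) (⋃ j, B' j) ∧
        IsEffectiveCartier (G₀.comap (ρ ≫ σ)) := by
  -- `H ≡ ν_reg` on the round-start host
  have hHr : ∀ y ∈ Xr, CJSHistory.hsFunOn Zr Xr 2 y = iterPSum 2 Phi := by
    obtain ⟨Dr, hDrc, hDrreg, hDrsupp⟩ := hDr
    have hDreq : Dr = vanishingIdeal ⟨closure Xr, isClosed_closure⟩ := by
      rw [eq_vanishingIdeal_support_of_isRegular Dr hDrreg]
      congr 1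
      exact Closeds.ext (by simp [hDrsupp])
    have hreg' : Scheme.IsRegular (vanishingIdeal (⟨closure Xr, isClosed_closure⟩ : Closeds Zr)).subscheme := by
      rw [← hDreq]; exact hDrreg
    have hdimX : topologicalKrullDim Xr ≤ 2 := by
      rw [← hDrsupp]; exact topologicalKrullDim_support_le_two hdimr hDrc
    intro y hy
    exact hsFunOn_eq_iterPSum_of_isRegular hXrc hreg' hdimX hy
  intro Z' ρ X' B' k' O' h
  induction h with
  | refl =>
    refine ⟨inferInstance, inferInstance, hZr, hdimr, hkr, hBr0, hBrc, hXrc, hDr, hOr, ?_, ?_⟩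
    · simpa using hseqr
    · simpa using hGr
  | @blowup Z' Z'' ρ X' B' k' O' h hZreg hBsnc C τ hτ hreg hsub hperm hnc hBsing hmax ih =>
    obtain ⟨hint, hnoeth, hZ', hdim', hk', hB'0, hB'c, hX'c, ⟨D', hD'c, hD'reg, hD'supp⟩, hO', hseq', hG'⟩ := ih
    haveI := hint
    haveI := hnoeth
    have hclX : closure X' = X' := hX'c.closure_eq
    -- the host IS the ideal of the strict transform
    have hD'eq : D' = vanishingIdeal ⟨closure X', isClosed_closure⟩ := by
      rw [eq_vanishingIdeal_support_of_isRegular D' hD'reg]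
      congr 1
      exact Closeds.ext (by simp [hD'supp])
    have hD'C : D' ≤ C := hD'eq ▸ hsub
    have hCX : (C.support : Set Z') ⊆ X' := support_subset_of_hsub hX'c hsub
    -- `H ≡ ν_reg` on the current host
    have hregX' : Scheme.IsRegular (vanishingIdeal (⟨closure X', isClosed_closure⟩ : Closeds Z')).subscheme := by
      rw [← hD'eq]; exact hD'reg
    have hdimX' : topologicalKrullDim X' ≤ 2 := by
      rw [← hD'supp]; exact topologicalKrullDim_support_le_two hdim' hD'c
    have hH' : ∀ y ∈ X', CJSHistory.hsFunOn Z' X' 2 y = iterPSum 2 Phi := fun y hy =>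
      hsFunOn_eq_iterPSum_of_isRegular hX'c hregX' hdimX' hy
    -- (K-b): every centre point lies on an OLD-label member
    have hold : ∀ x ∈ (C.support : Set Z'), x ∈ ⋃ j ∈ Set.Iio k, B' j := by
      intro x hx
      have hxX : x ∈ X' := hCX hx
      obtain ⟨hneq, hmaxr, -⟩ := hmax x hx
      set U := connectedComponentIn Xr (ρ x) with hU
      have hUsub : U ⊆ Xr := connectedComponentIn_subset _ _
      have hS : ∀ w ∈ CJSHistory.hsOOn Zr Xr 2 Or '' U, (ofLex w).1 = iterPSum 2 Phi := by
        rintro _ ⟨y, hy, rfl⟩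
        rw [CJSHistory.hsOOn_eq, ofLex_toLex, hHr y (hUsub hy)]
      have hne : ∃ y₁ ∈ U, ∃ y₂ ∈ U, CJSHistory.hsOOn Zr Xr 2 Or y₁ ≠ CJSHistory.hsOOn Zr Xr 2 Or y₂ := by
        by_contra hall
        push Not at hall
        exact hneq hall
      obtain ⟨y₁, hy₁, y₂, hy₂, hne12⟩ := hne
      have h1 := one_le_snd_of_maximal hS ⟨y₁, hy₁, rfl⟩ ⟨y₂, hy₂, rfl⟩ hne12 hmaxr
      rw [CJSHistory.hsOOn_eq, ofLex_toLex] at h1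
      have hne' : (O' x).Nonempty := Set.nonempty_of_ncard_ne_zero (by
        change 1 ≤ (O' x).ncard at h1
        omega)
      obtain ⟨j, hj⟩ := hne'
      rw [hO' x hxX] at hj
      exact Set.mem_biUnion hj.1 hj.2
    -- non-zero centre and the new ambient threefold
    have hCne : C ≠ ⊥ := fun hC0 =>
      ne_bot_of_isEffectiveCartier' hD'c (le_bot_iff.mp (hC0 ▸ hD'C))
    haveI : IsIntegral Z'' := hτ.isIntegral hCne
    haveI : IsNoetherian Z'' := isNoetherian_of_isBlowup hτ
    have hZ'' : Scheme.IsRegular Z'' := IsBlowup.isRegular_of_isRegular_subscheme hZ' hreg hτ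
    have hdim'' : topologicalKrullDim Z'' = 3 := by
      haveI := hτ.isProper
      rw [← hdim']
      exact (IsModification.of_isBlowup hτ hCne).isBirational.topologicalKrullDim_eq_of_isProper
    -- the new host
    obtain ⟨hD''c, hD''reg⟩ := regularHost_controlledTransform hZ' hD'c hD'reg hreg hD'C hτ
    have hD''supp : ((controlledTransform τ C D' 1).support : Set Z'') =
        closure (τ ⁻¹' (X' \ (C.support : Set Z'))) := by
      rw [support_controlledTransform_eq_closure_of_isRegular hZ' hD'reg hreg hD'C hτ, hD'supp]
    have hX''c : IsClosed (closure (τ ⁻¹' (X' \ (C.support : Set Z')))) := isClosed_closure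
    have hregX'' : Scheme.IsRegular (vanishingIdeal (⟨closure (closure (τ ⁻¹' (X' \ (C.support : Set Z')))),
        isClosed_closure⟩ : Closeds Z'')).subscheme := by
      have heq : controlledTransform τ C D' 1 = vanishingIdeal ⟨closure (closure (τ ⁻¹' (X' \ (C.support : Set Z')))),
          isClosed_closure⟩ := by
        rw [eq_vanishingIdeal_support_of_isRegular _ hD''reg]
        congr 1
        exact Closeds.ext (by simp [hD''supp])
      rw [← heq]; exact hD''reg
    have hdimX'' : topologicalKrullDim (closure (τ ⁻¹' (X' \ (C.support : Set Z')))) ≤ 2 := by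
      rw [← hD''supp]; exact topologicalKrullDim_support_le_two hdim'' hD''c
    have hH'' : ∀ y ∈ closure (τ ⁻¹' (X' \ (C.support : Set Z'))),
        CJSHistory.hsFunOn Z'' (closure (τ ⁻¹' (X' \ (C.support : Set Z')))) 2 y = iterPSum 2 Phi := fun y hy =>
      hsFunOn_eq_iterPSum_of_isRegular hX''c hregX'' hdimX'' hy
    -- the transported sequence, re-keyed to the transformed boundary members
    have hBU : (⋃ i, CJSHistory.boundaryTransform τ B' k' (C.support : Set Z') i) =
        τ ⁻¹' ((⋃ i, B' i) ∪ (C.support : Set Z')) :=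
      iUnion_boundaryTransform τ hB'0 hBsnc.isClosed C.support.isClosed
    have hBold : (⋃ i ∈ Set.Iio k, CJSHistory.boundaryTransform τ B' k' (C.support : Set Z') i) =
        closure (τ ⁻¹' ((⋃ i ∈ Set.Iio k, B' i) \ (C.support : Set Z'))) :=
      biUnion_lt_boundaryTransform τ B' hk' C.support
    have hseq'' := IsOBPermissibleSequence.blowup hseq' C τ hτ hreg hsub hold hperm hnc
    refine ⟨inferInstance, inferInstance, hZ'', hdim'', Nat.le_succ_of_le hk', ?_, ?_, hX''c,
      ⟨controlledTransform τ C D' 1, hD''c, hD''reg, hD''supp⟩, ?_, ?_, ?_⟩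
    · -- members beyond the new counter are empty
      intro j hj
      exact CJSHistory.boundaryTransform_of_gt τ B' k' _ (Nat.lt_of_succ_le hj)
    · -- members are closed
      intro j
      rcases lt_trichotomy j k' with hj | rfl | hj
      · rw [CJSHistory.boundaryTransform_of_lt τ B' k' _ hj]; exact isClosed_closure
      · rw [CJSHistory.boundaryTransform_self]; exact C.support.isClosed.preimage τ.continuous
      · rw [CJSHistory.boundaryTransform_of_gt τ B' k' _ hj]; exact isClosed_empty
    · -- history = old labels through the point (near case everywhere: `H ≡ ν_reg` before and after)
      intro x' hx'
      have hτx : τ x' ∈ X' :=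
        closure_minimal ((Set.preimage_mono Set.sdiff_subset)) (hX'c.preimage τ.continuous) hx'
      refine histTransform_eq_old τ _ _ hk' (fun j _ => hB'c j) (C.support : Set Z') (hO' (τ x') hτx) ?_
      rw [hH'' x' hx', hH' (τ x') hτx]
    · rw [hBold, hBU, Category.assoc]
      exact hseq''
    · rw [Scheme.IdealSheafData.comap_comp, Scheme.IdealSheafData.comap_comp]
      rw [Scheme.IdealSheafData.comap_comp] at hG'
      exact hG'.comap_of_isBlowup hτ

/-! ## §2 The (K-b) transport along the whole process (iterated rounds) -/

/-- **(K-b) TRANSPORT ALONG THE WHOLE PROCESS** (Cor. 6.26's iteration of rounds): from the START `(Supp D, 𝓑, O = 𝓑(·))` with a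
regular Cartier host `D`, the invariant of `obInv_elimination` holds at the end of every `IsSigmaOMaxProcess`.
[cite: CossartJannsenSaito2020, Cor. 6.26 (proof), Def. 6.23] -/
theorem obInv_process
    {E : Scheme.{u}} [IsIntegral E] [IsNoetherian E] (hE : Scheme.IsRegular E) (hdim : topologicalKrullDim E = 3)
    {X₀ : Set E} {B₀ : ℕ → Set E} {k : ℕ} {G₀ : E.IdealSheafData}
    (hB0 : ∀ j, k ≤ j → B₀ j = ∅) (hBc : ∀ j, IsClosed (B₀ j)) (hXc : IsClosed X₀)
    (hD : ∃ D : E.IdealSheafData, IsEffectiveCartier D ∧ Scheme.IsRegular D.subscheme ∧ (D.support : Set E) = X₀)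
    (hG : IsEffectiveCartier G₀) :
    ∀ {Z' : Scheme.{u}} {π : Z' ⟶ E} {X' : Set Z'} {B' : ℕ → Set Z'} {k' : ℕ} {O' : Z' → Set ℕ},
      CJSHistory.IsSigmaOMaxProcess X₀ B₀ k (BoundaryHistory.boundaryAt B₀) 2 π X' B' k' O' →
      ∃ (_ : IsIntegral Z') (_ : IsNoetherian Z'), Scheme.IsRegular Z' ∧ topologicalKrullDim Z' = 3 ∧
        k ≤ k' ∧ (∀ j, k' ≤ j → B' j = ∅) ∧ (∀ j, IsClosed (B' j)) ∧ IsClosed X' ∧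
        (∃ D' : Z'.IdealSheafData, IsEffectiveCartier D' ∧ Scheme.IsRegular D'.subscheme ∧
          (D'.support : Set Z') = X') ∧
        (∀ x ∈ X', O' x = Set.Iio k ∩ BoundaryHistory.boundaryAt B' x) ∧
        IsOBPermissibleSequence X₀ (⋃ j, B₀ j) π X' (⋃ j ∈ Set.Iio k, B' j) (⋃ j, B' j) ∧
        IsEffectiveCartier (G₀.comap π) := by
  intro Z' π X' B' k' O' h
  induction h with
  | refl =>
    refine ⟨inferInstance, inferInstance, hE, hdim, le_rfl, hB0, hBc, hXc, hD,
      fun x _ => boundaryAt_eq_inter_of_empty hB0 x, ?_, ?_⟩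
    · rw [biUnion_lt_eq_iUnion_of_empty hB0]
      exact IsOBPermissibleSequence.refl
    · simpa using hG
  | @round Z' Z'' σ X' B' k' O' h hnot ρ X'' B'' k'' O'' hr hdone ih =>
    obtain ⟨hint, hnoeth, hZ', hdim', hk', hB'0, hB'c, hX'c, hD', hO', hseq', hG'⟩ := ih
    haveI := hint
    haveI := hnoeth
    exact obInv_elimination hZ' hdim' hk' hB'0 hB'c hX'c hD' hO' hseq' hG' hr

/-! ## §3 The corollary: `OldBoundaryResolution₃` from F-72 -/

/-- No irreducible component of the regular host lies in the boundary, in the form F-72 consumes, from the coheight clause of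
`OldBoundaryResolution₃`: the generic point of a component of `Supp D` has coheight `≤ 1` (Krull). [folklore] -/
theorem not_subset_of_coheight {E : Scheme.{u}} [IsLocallyNoetherian E] {D : E.IdealSheafData} (hD : IsEffectiveCartier D)
    {B : Set E} (hcoh : ∀ x ∈ D.support, x ∈ B → 1 < Order.coheight x) :
    ∀ T ∈ irreducibleComponents ↥(D.subscheme), ¬ T ⊆ D.subschemeι ⁻¹' B := by
  intro T hT hTB
  set ι := D.subschemeι with hι
  have hTc : IsClosed T := isClosed_of_mem_irreducibleComponents T hT
  have hTirr : IsIrreducible T := hT.1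
  have hgen : IsGenericPoint hTirr.genericPoint T := by
    have := hTirr.isGenericPoint_genericPoint_closure
    rwa [hTc.closure_eq] at this
  set t := hTirr.genericPoint with ht
  have htT : t ∈ T := hgen.mem
  have hx : ι t ∈ (D.support : Set E) := by
    rw [← Scheme.IdealSheafData.range_subschemeι]; exact Set.mem_range_self t
  -- a coheight-`≤ 1` generisation of `ι t` inside `Supp D` must be `ι t` itself
  obtain ⟨ξ, hξD, hξx, hξ1⟩ := hD.exists_specializes_coheight_le_one hx
  obtain ⟨s, rfl⟩ : ξ ∈ Set.range ι := by rw [Scheme.IdealSheafData.range_subschemeι]; exact hξD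
  have hst : s ⤳ t := (ι.isClosedEmbedding.isInducing.specializes_iff).mp hξx
  -- `closure {s}` is irreducible and contains the component `T = closure {t}`, hence equals it
  have hTsub : T ⊆ closure {s} := by
    rw [← hgen.def]
    exact closure_minimal (Set.singleton_subset_iff.mpr hst.mem_closure) isClosed_closure
  have hTeq : closure {s} = T := le_antisymm (hT.2 isIrreducible_singleton.closure hTsub) hTsub
  have hsT : s ∈ T := hTeq ▸ subset_closure rfl
  have hts : t ⤳ s := hgen.specializes hsT
  have hseq : s = t := (hst.antisymm hts).eq
  subst hseq
  have h1 := hcoh (ι t) hx (hTB htT)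
  exact absurd hξ1 (not_le.mpr h1)

/-- **`OldBoundaryResolution₃` DISCHARGED from F-72** (`CossartJannsenSaito2020_canonicalSequence_history`, ν̃-form p533571): the
F-60♯-shaped OURS binder of res-D-pv-016's phase-2 closer is a kernel COROLLARY of the Cossart–Jannsen–Saito history
construction-fact.  The host being a regular hypersurface at every stage (`regularHost_controlledTransform`), `H_X ≡ ν_reg`
(`hsFunOn_eq_iterPSum_of_isRegular`), so the history is never reset and stays «the old labels through the point»
(`histTransform_eq_old`); a centre point carries a ROUND-START maximal value (the ν̃-conjunct of `hmax`) of a component that is not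
`O`-equisingular, hence `|O(x)| ≥ 1` (`one_le_snd_of_maximal`), i.e. it lies on the strict transform of an INITIAL boundary
component — the `hold` clause of `IsOBPermissibleSequence`; the END `X₁ ∪ ⋃B₁` is snc by `IsTransversalWith.isStrictNormalCrossingsDivisor_union`
with the Cartier pull-back of `D · 𝓘_B`. [cite: CossartJannsenSaito2020, Thm. 1.4, Cor. 6.26, Def. 6.23 (1), Rem. 6.24, (4.6), Lemma 4.27]
[cite: DeJong1996, 2.4] -/
theorem oldBoundaryResolution₃_of_F72 (h72 : CossartJannsenSaito2020_canonicalSequence_history.{u}) :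
    OldBoundaryResolution₃.{u} := by
  intro E _ _ hE hexc hdim D B hD hDreg hBsnc hcoh
  -- present the boundary by its irreducible components
  obtain ⟨Bf, k, hBU, hB0, hBcomp, hBinj, hBc⟩ := exists_componentLabelling hBsnc.isClosed
  -- the host as a closed immersion of a reduced surface
  haveI : IsReduced D.subscheme := hDreg.isReduced
  have hrange : Set.range D.subschemeι = (D.support : Set E) := Scheme.IdealSheafData.range_subschemeι D
  have hdimX : topologicalKrullDim ↥(D.subscheme) ≤ 2 := by
    rw [IsHomeomorph.topologicalKrullDim_eq _
      D.subschemeι.isClosedEmbedding.isEmbedding.toHomeomorph.isHomeomorph, Scheme.IdealSheafData.range_subschemeι]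
    exact topologicalKrullDim_support_le_two hdim hD
  have hBsnc' : IsStrictNormalCrossingsDivisor E (⋃ j, Bf j) := by rw [hBU]; exact hBsnc
  have hBcomp' : ∀ j < k, Bf j ∈ CJSHistory.irreducibleComponentsOf E (⋃ j, Bf j) := by rw [hBU]; exact hBcomp
  have hcompX : ∀ T ∈ irreducibleComponents ↥(D.subscheme), ¬ T ⊆ D.subschemeι ⁻¹' ⋃ j, Bf j := by
    rw [hBU]; exact not_subset_of_coheight hD hcoh
  obtain ⟨Z₁, π, X₁, B₁, k₁, O₁, hproc, -, -, -, -, -, -, hB₁snc, htot, htr⟩ :=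
    h72 D.subscheme E D.subschemeι Bf k hE hexc hdimX hBsnc' hB0 hBcomp' hBinj hcompX
  -- the END divisor `D · 𝓘_B`, pulled back
  have hBcart : IsEffectiveCartier (vanishingIdeal ⟨B, hBsnc.isClosed⟩) := hBsnc.isEffectiveCartier_vanishingIdeal
  have hG₀ : IsEffectiveCartier (D * vanishingIdeal ⟨B, hBsnc.isClosed⟩) := hD.mul hBcart
  -- transport along the process
  obtain ⟨hint, hnoeth, -, -, -, -, -, hX₁c, -, -, hseq, hG⟩ :=
    obInv_process (X₀ := Set.range D.subschemeι) hE hdim hB0 hBc (by rw [hrange]; exact D.support.isClosed)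
      ⟨D, hD, hDreg, hrange.symm⟩ hG₀ hproc
  haveI := hint
  haveI := hnoeth
  rw [hrange, hBU] at hseq
  refine ⟨Z₁, π, X₁, ⋃ j ∈ Set.Iio k, B₁ j, ⋃ j, B₁ j, hseq, ?_, ?_⟩
  · -- `X₁ ∪ ⋃B₁ = Supp π^*(D · 𝓘_B)` is a strict normal crossings divisor
    have hsuppG : ((D * vanishingIdeal ⟨B, hBsnc.isClosed⟩).support : Set E) = (D.support : Set E) ∪ B := by
      rw [Scheme.IdealSheafData.support_mul, Closeds.coe_sup, Scheme.IdealSheafData.coe_support_vanishingIdeal]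
      rfl
    have hcl : (⟨closure (X₁ ∪ ⋃ j, B₁ j), isClosed_closure⟩ : Closeds Z₁) =
        ((D * vanishingIdeal ⟨B, hBsnc.isClosed⟩).comap π).support := by
      apply Closeds.ext
      change closure (X₁ ∪ ⋃ j, B₁ j) = ((((D * vanishingIdeal ⟨B, hBsnc.isClosed⟩).comap π).support : Set Z₁))
      rw [(hX₁c.union hB₁snc.isClosed).closure_eq, Scheme.IdealSheafData.support_comap, Closeds.coe_preimage, hsuppG,
        ← hrange, ← hBU, ← htot]
    refine htr.isStrictNormalCrossingsDivisor_union hB₁snc hX₁c fun x _ => ?_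
    obtain ⟨t, ht, hst⟩ := hG.exists_stalkIdeal_eq_span x
    refine ⟨t, nonZeroDivisors.ne_zero ht, ?_⟩
    rw [hcl, vanishingIdeal_support, stalkIdeal_radical, hst]
  · rw [← hrange, ← hBU]; exact htot

end Summit.ResolutionOfSingularities.ResolutionOfSingularities.Theorems.DepthLegal

end
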